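import Summits.Ventures.HSemireg.TwoSlotGlue
import Summits.Ventures.HSemireg.MixedFrameGlue

/-!
# The 2-adic readings in the integral exterior algebra (pub-hsemireg, S4-PUSH corner 2)

Kernel leg of seat s4-search-2 gen 15 (cell `pub-hsemireg`) for §5 of `s4push/search-2/g11/LIFT2-search-2-g11.md`
(«S2-21», the hand analysis of the M2 decision; PREREG-S2-19 §1 for CRITERION L).  Companions (tree):
`TwoSlotFrameTable` (atom tables), `DegreeSixSecondDigit` (LEMMAS A(a), B, D(a) as ring identities),
`MixedFrameLeadingDigit` (LEMMA A(b)), `CliqueUnitKills` (LEMMAS D(b) ∕ E), and the joins `TwoSlotGlue`,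
`MixedFrameGlue` (the same identities for the ACTUAL 2-vectors `hᵢ = ι x_{2i} ι x_{2i+1}` of Mathlib's
`ExteriorAlgebra R M`, no multiplication-table hypothesis).  Of record those files leave PENCIL the 2-adic
READING of each identity in `Λ^{ev}ℤ¹²` («`v₂(T₃) = 8 < 10` ⇒ CLASS-DEAD», «`x₀∧⋯∧x₁₁ ∈ 2Λ` is impossible, so no
first digit», the torsion-free «iff»; wording rule of s4-ref g38 ∕ g39).  This file proves the readings.

**Setting.** `M` a free `ℤ`-module with a basis `x : Fin 12 → M` (`Module.Basis (Fin 12) ℤ M`; the module of record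
is `ℤ¹² = H¹(E⁶, ℤ)` with its symplectic basis, slot `i` = `⟨x (2i), x (2i+1)⟩ = H¹` of the `i`-th factor), and
`ExteriorAlgebra ℤ M = Λ^•M`.  The tool (§1) is an INTEGER-VALUED COEFFICIENT FUNCTIONAL: `τ ∘ Λ(π)`, where
`π : M → ℤ⁶` (resp. `ℤ¹²`) is the coordinate projection of the basis (`Basis.equivFun`, `LinearMap.funLeft`),
`Λ(π) = ExteriorAlgebra.map π` (functoriality) and `τ` is the top coefficient of `Λ(ℤ^k)` — Mathlib's
`ExteriorAlgebra.liftAlternating` of the determinant `Matrix.detRowAlternating` in degree `k` (`exists_topCoeff`;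
value `det 1 = 1` on `e₀ ∧ ⋯ ∧ e_{k−1}`).  `Λ(π)` kills every slot outside the chosen coordinates, so the functional
reads off the coefficient of `x₀∧⋯∧x₅` (resp. of the top class) as an integer, and a congruence `T = 2^g · Z` in
`Λ^•M` becomes an integer congruence refuted by `omega` (no basis theorem for `Λ^•M`, no torsion-freeness lemma).

**Proved** (theorems only, count-neutral, no `def`; `R = ℤ` throughout §2–§3, identities in §3 for any `R`):
* `top_class_ne_two_mul`: `ι x₀ ⋯ ι x₁₁ ≠ 2·W` for every `W`.
* `lemmaB_reading` — LEMMA B (the decisive kill of the 83 (2,2,3,3,3,3)-edge classes):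
  in the setting of `TwoSlotGlue.lemmaB_exterior` (registered `T₃' = T₃(B + 4Y)`, `B = (1+2η)H + 2S₁ + 2L`, ANY even
  remainder `Y` with divided powers `Y₂, Y₃`), `T₃' ≠ 512·Z` and `T₃' ≠ 1024·Z` for every `Z`: CRITERION L at
  `k = 3` (`≡ 0 mod 2^{m(2k−1)} = 2^{10}`) fails for every completion — the memo's «`v₂(T₃) = 8 < 10`».
* `lemmaA_a_reading` — LEMMA A(a), inconsistent direction (setting of `TwoSlotGlue.obstruction_exterior`, any
  cross-line functional with even pairing): the digit equation `pH₂ − HS₁ + CX = 2W` has no solution.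
* `lemmaA_b_reading` — LEMMA A(b) (setting of `MixedFrameGlue.obstruction_mixed_exterior`, the 63
  (1,2,3,3,3,3)-frame classes): the digit equation `e·h₀h₁ + h₀S₁ + CX = 2W` has no solution.
* LEMMA D(b), type (2,2,2,2,3,5), with an arbitrary even remainder `Z` (σ-parameters any even elements):
  `T3Z_Km2235_frame` ∕ `T3Z_Km2235_exterior` (the registered `T₃` at `P₁ + 2Z`, divided powers `E₂, E₃` as in
  `lemmaB`; `= 2⁷·(2s+2u+1−6t)·P₃ + 2⁸·(explicit)`) and `lemmaD_b_reading_Km2235_completion`: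
  `T₃(P₁ + 2Z) ≠ 256·Z'` for every `Z, Z'` (`v₂ = 7 < 8 ≤ 10`) — the `(k, v, g) = (3, 7, 8)` (V)-kill end to
  end.  The other six clique types of LEMMAS D(b) ∕ E compose identically and are not restated.

What stays pencil ∕ machine after this file: the COVERAGE case analyses (a functional with even pairing exists for
15 ∕ 16 leading digits; A(b)'s parity cases; LEMMA A(a)'s digit-space clause), LEMMA C, the E = ∅ dimension-0
units, the (S1) ∕ (S3) index formulas, the census counts and the tower framework itself (that CRITERION L is the
registered necessary condition).  Scope ∕ honest framing as in the companions: integer linear algebra on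
`Λ^•ℤ¹²`; a kernel check of the READING steps of a CLASS-LEVEL necessary-condition sieve (CRITERION L) at the
special fibre `E⁶`; no object, no `σ` computation, no Ext group, no Hodge statement; nothing here bears on HC ∕
HC_CM ∕ HC_AV.
-/

namespace Summit.Ventures.HSemireg.TwoAdicReadings

open ExteriorAlgebra

section Functionals

/-! ### 1. Integer-valued coefficient functionals on `ExteriorAlgebra ℤ M` -/

/-- **Top coefficient on `Λ(R^k)`.**  There is an `R`-linear functional `τ` on `ExteriorAlgebra R (Fin k → R)` with
`τ (e₀ ∧ ⋯ ∧ e_{k-1}) = 1` (`eᵢ = Pi.single i 1`): Mathlib's `ExteriorAlgebra.liftAlternating` of the family of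
alternating maps that is the determinant (`Matrix.detRowAlternating`) in degree `k` and `0` in every other degree;
the value is `det 1 = 1`.  No basis theorem for the exterior algebra is used. -/
theorem exists_topCoeff (R : Type*) [CommRing R] (k : ℕ) :
    ∃ τ : ExteriorAlgebra R (Fin k → R) →ₗ[R] R, τ (ιMulti R k (fun i => Pi.single i 1)) = 1 := by
  classical
  refine ⟨liftAlternating (Function.update 0 k Matrix.detRowAlternating), ?_⟩
  rw [liftAlternating_apply_ιMulti, Function.update_self]
  change Matrix.det (Matrix.of fun i => Pi.single i (1 : R)) = 1
  have : (Matrix.of fun i => Pi.single i (1 : R) : Matrix (Fin k) (Fin k) R) = 1 := by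
    ext i j
    simp [Matrix.one_apply, Pi.single_apply, eq_comm]
  rw [this, Matrix.det_one]

/-- The six-fold product `ι e₀ · (ι e₁ · (⋯ · ι e₅))` in `Λ(R⁶)` is `ιMulti R 6 e`. -/
theorem prod_six_eq_ιMulti (R : Type*) [CommRing R] :
    ι R (Pi.single 0 1 : Fin 6 → R) * (ι R (Pi.single 1 1 : Fin 6 → R) * (ι R (Pi.single 2 1 : Fin 6 → R)
      * (ι R (Pi.single 3 1 : Fin 6 → R) * (ι R (Pi.single 4 1 : Fin 6 → R) * ι R (Pi.single 5 1 : Fin 6 → R)))))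
      = ιMulti R 6 (fun i => (Pi.single i 1 : Fin 6 → R)) := by
  rw [ιMulti_apply]
  simp [List.ofFn_succ]

/-- The twelve-fold product `ι e₀ · (ι e₁ · (⋯ · ι e₁₁))` in `Λ(R¹²)` is `ιMulti R 12 e`. -/
theorem prod_twelve_eq_ιMulti (R : Type*) [CommRing R] :
    ι R (Pi.single 0 1 : Fin 12 → R) * (ι R (Pi.single 1 1 : Fin 12 → R) * (ι R (Pi.single 2 1 : Fin 12 → R)
      * (ι R (Pi.single 3 1 : Fin 12 → R) * (ι R (Pi.single 4 1 : Fin 12 → R) * (ι R (Pi.single 5 1 : Fin 12 → R)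
      * (ι R (Pi.single 6 1 : Fin 12 → R) * (ι R (Pi.single 7 1 : Fin 12 → R) * (ι R (Pi.single 8 1 : Fin 12 → R)
      * (ι R (Pi.single 9 1 : Fin 12 → R) * (ι R (Pi.single 10 1 : Fin 12 → R)
      * ι R (Pi.single 11 1 : Fin 12 → R))))))))))) = ιMulti R 12 (fun i => (Pi.single i 1 : Fin 12 → R)) := by
  rw [ιMulti_apply]
  simp [List.ofFn_succ]

/-- A `ℤ`-linear functional commutes with numerals, `φ (n · Z) = n · φ Z` (only additivity is used). -/
theorem apply_ofNat_mul {A : Type*} [Ring A] [Module ℤ A] (φ : A →ₗ[ℤ] ℤ) (n : ℕ) [n.AtLeastTwo] (Z : A) :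
    φ (OfNat.ofNat n * Z) = OfNat.ofNat n * φ Z := by
  rw [show (OfNat.ofNat n : A) * Z = (OfNat.ofNat n : ℕ) • Z by rw [nsmul_eq_mul, Nat.cast_ofNat],
    map_nsmul, nsmul_eq_mul, Nat.cast_ofNat]

/-- A `ℤ`-linear functional commutes with integer casts, `φ (c · Z) = c · φ Z` (only additivity is used). -/
theorem apply_intCast_mul {A : Type*} [Ring A] [Module ℤ A] (φ : A →ₗ[ℤ] ℤ) (c : ℤ) (Z : A) :
    φ ((c : A) * Z) = c * φ Z := by
  rw [← zsmul_eq_mul, map_zsmul, smul_eq_mul]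

variable {M : Type*} [AddCommGroup M] [Module ℤ M]

/-- Coordinates of a basis vector: `b.equivFun (b i) = eᵢ`. -/
theorem equivFun_basis (b : Module.Basis (Fin 12) ℤ M) (i : Fin 12) :
    (b.equivFun : M →ₗ[ℤ] (Fin 12 → ℤ)) (b i) = Pi.single i 1 := by
  funext j
  simp [Pi.single_apply, eq_comm]

/-- The projection `M → ℤ⁶` to the coordinates `0, …, 5` of the basis `b`: `b 0, …, b 5 ↦ e₀, …, e₅`, `b 6, … ↦ 0`. -/
theorem projSix_basis (b : Module.Basis (Fin 12) ℤ M) (i : Fin 12) :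
    (LinearMap.funLeft ℤ ℤ (Fin.castLE (show 6 ≤ 12 by decide)) ∘ₗ (b.equivFun : M →ₗ[ℤ] (Fin 12 → ℤ))) (b i)
      = (![Pi.single 0 1, Pi.single 1 1, Pi.single 2 1, Pi.single 3 1, Pi.single 4 1, Pi.single 5 1,
          0, 0, 0, 0, 0, 0] : Fin 12 → (Fin 6 → ℤ)) i := by
  funext j
  simp only [LinearMap.coe_comp, Function.comp_apply, LinearMap.funLeft_apply, LinearEquiv.coe_coe,
    Module.Basis.equivFun_self, Fin.ext_iff, Fin.val_castLE]
  fin_cases i <;> fin_cases j <;> simp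

/-- **The top class is not divisible by 2.**  For any basis `b` of a free `ℤ`-module `M` of rank 12, the top
exterior product `b₀ ∧ b₁ ∧ ⋯ ∧ b₁₁` is not of the form `2·W` in `ExteriorAlgebra ℤ M` (`W` arbitrary, of any
degree): the top coefficient `τ ∘ Λ(b.equivFun)` (integer-valued, `1` on the top class) would give `1 = 2·τ(W)`. -/
theorem top_class_ne_two_mul (b : Module.Basis (Fin 12) ℤ M) (W : ExteriorAlgebra ℤ M) :
    ι ℤ (b 0) * ι ℤ (b 1) * ι ℤ (b 2) * ι ℤ (b 3) * ι ℤ (b 4) * ι ℤ (b 5) * ι ℤ (b 6) * ι ℤ (b 7)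
      * ι ℤ (b 8) * ι ℤ (b 9) * ι ℤ (b 10) * ι ℤ (b 11) ≠ 2 * W := by
  obtain ⟨τ, hτ⟩ := exists_topCoeff ℤ 12
  intro h
  have key := congrArg (fun z => τ ((ExteriorAlgebra.map (b.equivFun : M →ₗ[ℤ] (Fin 12 → ℤ))) z)) h
  simp only [map_mul, map_apply_ι, equivFun_basis, map_ofNat, mul_assoc] at key
  rw [prod_twelve_eq_ιMulti, hτ, apply_ofNat_mul τ 2] at key
  have k2 : (1 : ℤ) = 2 * τ (ExteriorAlgebra.map (b.equivFun : M →ₗ[ℤ] (Fin 12 → ℤ)) W) := key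
  omega

end Functionals

section Readings

/-! ### 2. The readings: LEMMA B, LEMMA A(a), LEMMA A(b), LEMMA D(b) over `ℤ` -/

open TwoSlotGlue MixedFrameGlue

variable {M : Type*} [AddCommGroup M] [Module ℤ M]

/-- **LEMMA B READING (the decisive kill of the 83 (2,2,3,3,3,3)-edge M2 classes), in the kernel.**  Setting of
`TwoSlotGlue.lemmaB_exterior` at `R = ℤ`, for ANY free `ℤ`-module `M` with a basis `x : Fin 12` (slot `i` =
`⟨x (2i), x (2i+1)⟩`; the module of record is `ℤ¹² = H¹(E⁶, ℤ)` with its symplectic basis): the registered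
`T₃' = T₃(B + 4Y)` at `B = (1 + 2η)H + 2S₁ + 2L` (first digit `X = S₁ + L + ηH`), `Y, Y₂, Y₃` ANY even elements
(the remainder and its divided powers), parameters `s, t, u, η, a, b, c, d` any even elements (in the application
integers).  CONCLUSION: `T₃'` is NOT of the form `512 · Z` in `ExteriorAlgebra ℤ M`, nor (a fortiori) `1024 · Z`:
CRITERION L at `k = 3` (`T₃(B) ≡ 0 mod 2^{m(2k−1)} = 2^{10}`) fails for EVERY completion
`B = (1+2η)H + 2S₁ + 2L + 4Y` of the surviving branch of LEMMA A(a) (S2-21 §2 ∕ §5: «v(T₃) = 8 < 10 for EVERY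
completion ⇒ DEAD»).  Proof: `lemmaB_exterior` gives `T₃' = 256·H₂S₁ + 512·W`; apply the integer-valued
functional `Φ = τ ∘ Λ(π)` (`π : M → ℤ⁶` the coordinates `0–5` of `x`, `τ` the top coefficient of `Λ(ℤ⁶)`,
`exists_topCoeff`): `Λ(π)` kills `h₃, h₄, h₅` and `Φ(h₀h₁h₂) = 1`, so `Φ(T₃') = 256 + 512·Φ(W)`, which is not
`512·Φ(Z)`.  This is the memo's reading `v₂(T₃) = 8 < 10` (S2-21 §5 LEMMA B) as a theorem; no table hypothesis,
no basis theorem for the exterior algebra. -/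
theorem lemmaB_reading (x : Module.Basis (Fin 12) ℤ M)
    (Λ : Subalgebra ℤ (ExteriorAlgebra ℤ M)) (h₀ h₁ l₁ l₂ l₃ l₄ h₂ h₃ h₄ h₅ σ₀ σ₁ σ₂ σ₃ s t u η a b
    c d H H₂ S₁ S₂ S₃ L L₂ D D₂ D₃ B B₂ B₃ Y Y₂ Y₃ E₂ E₃ T₃' : ExteriorAlgebra ℤ M)
    (hΛ : Λ = Algebra.adjoin ℤ (Set.range fun p : M × M => ι ℤ p.1 * ι ℤ p.2))
    (hh₀ : h₀ = ι ℤ (x 0) * ι ℤ (x 1)) (hh₁ : h₁ = ι ℤ (x 2) * ι ℤ (x 3)) (hl₁ : l₁ = ι ℤ (x 0) * ι ℤ (x 2))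
    (hl₂ : l₂ = ι ℤ (x 0) * ι ℤ (x 3)) (hl₃ : l₃ = ι ℤ (x 1) * ι ℤ (x 2)) (hl₄ : l₄ = ι ℤ (x 1) * ι ℤ (x 3))
    (hh₂ : h₂ = ι ℤ (x 4) * ι ℤ (x 5)) (hh₃ : h₃ = ι ℤ (x 6) * ι ℤ (x 7)) (hh₄ : h₄ = ι ℤ (x 8) * ι ℤ (x 9))
    (hh₅ : h₅ = ι ℤ (x 10) * ι ℤ (x 11)) (ms : s ∈ Λ) (mt : t ∈ Λ) (mu : u ∈ Λ) (mη : η ∈ Λ) (ma : a ∈ Λ)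
    (mb : b ∈ Λ) (mc : c ∈ Λ) (md : d ∈ Λ) (mY : Y ∈ Λ) (mY₂ : Y₂ ∈ Λ) (mY₃ : Y₃ ∈ Λ)
    (hH : H = h₀ + h₁) (hH₂ : H₂ = h₀ * h₁) (hS₁ : S₁ = h₂ + h₃ + h₄ + h₅)
    (hS₂ : S₂ = h₂ * h₃ + h₂ * h₄ + h₂ * h₅ + h₃ * h₄ + h₃ * h₅ + h₄ * h₅)
    (hS₃ : S₃ = h₂ * h₃ * h₄ + h₂ * h₃ * h₅ + h₂ * h₄ * h₅ + h₃ * h₄ * h₅)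
    (hL : L = a * l₁ + b * l₂ + c * l₃ + d * l₄) (hL₂ : L₂ = (b * c - a * d) * H₂)
    (hD : D = 4 * H + 8 * S₁) (hD₂ : D₂ = 16 * H₂ + 32 * (H * S₁) + 64 * S₂)
    (hD₃ : D₃ = 128 * (H₂ * S₁) + 256 * (H * S₂) + 512 * S₃)
    (hB : B = (1 + 2 * η) * H + 2 * S₁ + 2 * L)
    (hB₂ : B₂ = (1 + 2 * η) ^ 2 * H₂ + 2 * (1 + 2 * η) * (H * (S₁ + L)) + 4 * (S₂ + S₁ * L + L₂))
    (hB₃ : B₃ = 2 * (1 + 2 * η) ^ 2 * (H₂ * (S₁ + L)) + 4 * (1 + 2 * η) * (H * (S₂ + S₁ * L + L₂))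
      + 8 * (S₃ + S₂ * L + S₁ * L₂))
    (hE₂ : E₂ = B₂ + 4 * (B * Y) + 16 * Y₂) (hE₃ : E₃ = B₃ + 4 * (B₂ * Y) + 16 * (B * Y₂) + 64 * Y₃)
    (hT₃' : T₃' = σ₃ * D₃ - 4 * σ₂ * (D₂ * (B + 4 * Y)) + 16 * σ₁ * (D * E₂) - 64 * σ₀ * E₃)
    (hσ₁ : σ₁ = 0) (hσ₂ : σ₂ = 4 * t - σ₀) (hσ₀ : σ₀ = 2 * s + 1) (hσ₃ : σ₃ = 4 * u) :
    ∀ Z : ExteriorAlgebra ℤ M, T₃' ≠ 512 * Z ∧ T₃' ≠ 1024 * Z := by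
  suffices main : ∀ Z : ExteriorAlgebra ℤ M, T₃' ≠ 512 * Z from
    fun Z => ⟨main Z, fun h => main (2 * Z) (by rw [h, ← mul_assoc]; norm_num)⟩
  intro Z hZ
  obtain ⟨W, hW⟩ : ∃ W, T₃' = 256 * (H₂ * S₁) + 512 * W :=
    ⟨_, lemmaB_exterior (x 0) (x 1) (x 2) (x 3) (x 4) (x 5) (x 6) (x 7) (x 8) (x 9) (x 10) (x 11) Λ h₀
      h₁ l₁ l₂ l₃ l₄ h₂ h₃ h₄ h₅ σ₀ σ₁ σ₂ σ₃ s t u η a b c d H H₂ S₁ S₂ S₃ L L₂ D D₂ D₃ B B₂ B₃ Y Y₂ Y₃ E₂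
      E₃ T₃' hΛ hh₀ hh₁ hl₁ hl₂ hl₃ hl₄ hh₂ hh₃ hh₄ hh₅ ms mt mu mη ma mb mc md mY mY₂ mY₃ hH hH₂ hS₁ hS₂
      hS₃ hL hL₂ hD hD₂ hD₃ hB hB₂ hB₃ hE₂ hE₃ hT₃' hσ₁ hσ₂ hσ₀ hσ₃⟩
  obtain ⟨τ, hτ⟩ := exists_topCoeff ℤ 6
  rw [hZ] at hW
  have key := congrArg (fun z => τ (ExteriorAlgebra.map
    (LinearMap.funLeft ℤ ℤ (Fin.castLE (show 6 ≤ 12 by decide)) ∘ₗ (x.equivFun : M →ₗ[ℤ] (Fin 12 → ℤ))) z)) hW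
  subst hH₂ hS₁ hh₀ hh₁ hh₂ hh₃ hh₄ hh₅
  simp only [map_mul, map_add, map_apply_ι, projSix_basis, Matrix.cons_val, map_ofNat, map_zero,
    mul_zero, add_zero, mul_add, mul_assoc, prod_six_eq_ιMulti] at key
  rw [apply_ofNat_mul τ 512, apply_ofNat_mul τ 512, apply_ofNat_mul τ 256, hτ] at key
  norm_num at key
  omega

/-- **LEMMA A(a) READING (inconsistent direction): no first digit exists.**  Setting of
`TwoSlotGlue.obstruction_exterior` at `R = ℤ`, `xᵢ` a basis of the free `ℤ`-module `M`: leading digit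
`C = β₀₁h₀ + β₂₃h₁ + N`, a cross-line functional `F = c₁l₁ + ⋯ + c₄l₄` whose pairing `ϖ` with `N` satisfies the
parity clause `β₂₃ + ϖ = 2m`.  CONCLUSION: the digit equation `p·H₂ − H·S₁ + C·X = 2·W` has NO solution
`(p, X, W)` (even elements).  Proof: `obstruction_exterior` turns a solution into `H₂S₄ = x₀∧⋯∧x₁₁ = 2·(…)`,
which `top_class_ne_two_mul` refutes.  The memo's reading «impossible over ℤ, so no first digit» (S2-21 §5 LEMMA
A(a)) as a theorem; the coverage count (such an `F` exists for 15 of the 16 (V)-surviving leading digits) stays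
pencil ∕ machine. -/
theorem lemmaA_a_reading (x : Module.Basis (Fin 12) ℤ M)
    (Λ : Subalgebra ℤ (ExteriorAlgebra ℤ M)) (h₀ h₁ l₁ l₂ l₃ l₄ h₂ h₃ h₄ h₅ p m ϖ n₁ n₂ n₃ n₄ c₁ c₂ c₃
    c₄ β₀₁ β₂₃ H H₂ S₁ S₄ G N F C X W : ExteriorAlgebra ℤ M)
    (hΛ : Λ = Algebra.adjoin ℤ (Set.range fun p : M × M => ι ℤ p.1 * ι ℤ p.2))
    (hh₀ : h₀ = ι ℤ (x 0) * ι ℤ (x 1)) (hh₁ : h₁ = ι ℤ (x 2) * ι ℤ (x 3)) (hl₁ : l₁ = ι ℤ (x 0) * ι ℤ (x 2))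
    (hl₂ : l₂ = ι ℤ (x 0) * ι ℤ (x 3)) (hl₃ : l₃ = ι ℤ (x 1) * ι ℤ (x 2)) (hl₄ : l₄ = ι ℤ (x 1) * ι ℤ (x 3))
    (hh₂ : h₂ = ι ℤ (x 4) * ι ℤ (x 5)) (hh₃ : h₃ = ι ℤ (x 6) * ι ℤ (x 7)) (hh₄ : h₄ = ι ℤ (x 8) * ι ℤ (x 9))
    (hh₅ : h₅ = ι ℤ (x 10) * ι ℤ (x 11)) (mp : p ∈ Λ) (mm : m ∈ Λ) (mn₁ : n₁ ∈ Λ) (mn₂ : n₂ ∈ Λ)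
    (mn₃ : n₃ ∈ Λ) (mn₄ : n₄ ∈ Λ) (mc₁ : c₁ ∈ Λ) (mc₂ : c₂ ∈ Λ) (mc₃ : c₃ ∈ Λ) (mc₄ : c₄ ∈ Λ)
    (mβ₀₁ : β₀₁ ∈ Λ) (mβ₂₃ : β₂₃ ∈ Λ) (mX : X ∈ Λ) (mW : W ∈ Λ)
    (hH : H = h₀ + h₁) (hH₂ : H₂ = h₀ * h₁) (hS₁ : S₁ = h₂ + h₃ + h₄ + h₅)
    (hS₄ : S₄ = h₂ * h₃ * h₄ * h₅) (hG : G = h₃ * h₄ * h₅)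
    (hN : N = n₁ * l₁ + n₂ * l₂ + n₃ * l₃ + n₄ * l₄) (hF : F = c₁ * l₁ + c₂ * l₂ + c₃ * l₃ + c₄ * l₄)
    (hϖ : ϖ = c₂ * n₃ + c₃ * n₂ - c₁ * n₄ - c₄ * n₁) (hC : C = β₀₁ * h₀ + β₂₃ * h₁ + N)
    (hm : β₂₃ + ϖ = 2 * m) :
    p * H₂ - H * S₁ + C * X ≠ 2 * W := by
  intro hX
  have key := obstruction_exterior (x 0) (x 1) (x 2) (x 3) (x 4) (x 5) (x 6) (x 7) (x 8) (x 9) (x 10) (x 11)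
    Λ h₀ h₁ l₁ l₂ l₃ l₄ h₂ h₃ h₄ h₅ p m ϖ n₁ n₂ n₃ n₄ c₁ c₂ c₃ c₄ β₀₁ β₂₃ H H₂ S₁ S₄ G N F C X W hΛ hh₀ hh₁
    hl₁ hl₂ hl₃ hl₄ hh₂ hh₃ hh₄ hh₅ mp mm mn₁ mn₂ mn₃ mn₄ mc₁ mc₂ mc₃ mc₄ mβ₀₁ mβ₂₃ mX mW hH hH₂ hS₁ hS₄ hG
    hN hF hϖ hC hX hm
  subst hH₂ hS₄ hh₀ hh₁ hh₂ hh₃ hh₄ hh₅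
  exact top_class_ne_two_mul x _ (by simp only [mul_assoc] at key ⊢; exact key)

/-- **LEMMA A(b) READING (the 63 (1,2,3,3,3,3)-frame M2 classes): no first digit exists.**  Setting of
`MixedFrameGlue.obstruction_mixed_exterior` at `R = ℤ`, `xᵢ` a basis of the free `ℤ`-module `M`: leading digit
`C = β₀₁h₀ + β₂₃h₁ + N`, functional `f = f₀₁h₀ + f₂₃h₁ + F` with `f₂₃ = 2r + 1` odd and even pairing
`f₀₁β₂₃ + f₂₃β₀₁ + ϖ = 2m`.  CONCLUSION: the digit equation `e·h₀h₁ + h₀·S₁ + C·X = 2·W` has NO solution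
`(e, X, W)`.  Proof: `obstruction_mixed_exterior` + `top_class_ne_two_mul`.  The memo's reading «impossible over
ℤ» (S2-21 §5 LEMMA A(b)) as a theorem; the parity case analysis producing `f` for each of the 28 leading digits
stays pencil ∕ machine. -/
theorem lemmaA_b_reading (x : Module.Basis (Fin 12) ℤ M)
    (Λ : Subalgebra ℤ (ExteriorAlgebra ℤ M)) (h₀ h₁ l₁ l₂ l₃ l₄ h₂ h₃ h₄ h₅ m r e f₀₁ f₂₃ ϖ β₀₁ β₂₃ n₁ n₂ n₃ n₄ c₁
    c₂ c₃ c₄ S₁ S₄ G N F f C X W : ExteriorAlgebra ℤ M)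
    (hΛ : Λ = Algebra.adjoin ℤ (Set.range fun p : M × M => ι ℤ p.1 * ι ℤ p.2))
    (hh₀ : h₀ = ι ℤ (x 0) * ι ℤ (x 1)) (hh₁ : h₁ = ι ℤ (x 2) * ι ℤ (x 3)) (hl₁ : l₁ = ι ℤ (x 0) * ι ℤ (x 2))
    (hl₂ : l₂ = ι ℤ (x 0) * ι ℤ (x 3)) (hl₃ : l₃ = ι ℤ (x 1) * ι ℤ (x 2)) (hl₄ : l₄ = ι ℤ (x 1) * ι ℤ (x 3))
    (hh₂ : h₂ = ι ℤ (x 4) * ι ℤ (x 5)) (hh₃ : h₃ = ι ℤ (x 6) * ι ℤ (x 7)) (hh₄ : h₄ = ι ℤ (x 8) * ι ℤ (x 9))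
    (hh₅ : h₅ = ι ℤ (x 10) * ι ℤ (x 11)) (mm : m ∈ Λ) (mr : r ∈ Λ) (me : e ∈ Λ) (mf₀₁ : f₀₁ ∈ Λ)
    (mf₂₃ : f₂₃ ∈ Λ) (mβ₀₁ : β₀₁ ∈ Λ) (mβ₂₃ : β₂₃ ∈ Λ) (mn₁ : n₁ ∈ Λ) (mn₂ : n₂ ∈ Λ) (mn₃ : n₃ ∈ Λ)
    (mn₄ : n₄ ∈ Λ) (mc₁ : c₁ ∈ Λ) (mc₂ : c₂ ∈ Λ) (mc₃ : c₃ ∈ Λ) (mc₄ : c₄ ∈ Λ) (mX : X ∈ Λ) (mW : W ∈ Λ)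
    (hS₁ : S₁ = h₂ + h₃ + h₄ + h₅) (hS₄ : S₄ = h₂ * h₃ * h₄ * h₅) (hG : G = h₃ * h₄ * h₅)
    (hN : N = n₁ * l₁ + n₂ * l₂ + n₃ * l₃ + n₄ * l₄) (hF : F = c₁ * l₁ + c₂ * l₂ + c₃ * l₃ + c₄ * l₄)
    (hϖ : ϖ = c₂ * n₃ + c₃ * n₂ - c₁ * n₄ - c₄ * n₁) (hC : C = β₀₁ * h₀ + β₂₃ * h₁ + N)
    (hf : f = f₀₁ * h₀ + f₂₃ * h₁ + F) (hm : f₀₁ * β₂₃ + f₂₃ * β₀₁ + ϖ = 2 * m) (hr : f₂₃ = 2 * r + 1) :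
    e * (h₀ * h₁) + h₀ * S₁ + C * X ≠ 2 * W := by
  intro hX
  have key := obstruction_mixed_exterior (x 0) (x 1) (x 2) (x 3) (x 4) (x 5) (x 6) (x 7) (x 8) (x 9) (x 10)
    (x 11) Λ h₀ h₁ l₁ l₂ l₃ l₄ h₂ h₃ h₄ h₅ m r e f₀₁ f₂₃ ϖ β₀₁ β₂₃ n₁ n₂ n₃ n₄ c₁ c₂ c₃ c₄ S₁ S₄ G N F f C X
    W hΛ hh₀ hh₁ hl₁ hl₂ hl₃ hl₄ hh₂ hh₃ hh₄ hh₅ mm mr me mf₀₁ mf₂₃ mβ₀₁ mβ₂₃ mn₁ mn₂ mn₃ mn₄ mc₁ mc₂ mc₃ mc₄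
    mX mW hS₁ hS₄ hG hN hF hϖ hC hf hX hm hr
  subst hS₄ hh₀ hh₁ hh₂ hh₃ hh₄ hh₅
  exact top_class_ne_two_mul x _ (by simp only [mul_assoc] at key ⊢; exact key)

end Readings

section Completion

/-! ### 3. LEMMA D(b) with an arbitrary remainder: `T₃(P₁ + 2Z)` (frame, exterior algebra, reading) -/

/-- **LEMMA D(b), type (2,2,2,2,3,5), at `B = P₁ + 2Z` on the frame (any commutative ring).**  Registered
expansion (S2-21 §1 (a), `d = 1`): `T₃(B + 2Z) = T₃(B) + 2K₃,₁(B)Z + 4K₃,₂(B)Z^[2] + 8K₃,₃Z^[3]`, realised —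
exactly as `DegreeSixSecondDigit.lemmaB` realises `T₃(B + 4Y)` — by the registered `T₃` at `P₁ + 2Z` with the
divided powers `E₂ = (P₁ + 2Z)^[2] = P₂ + 2P₁Z + 4Z₂`, `E₃ = (P₁ + 2Z)^[3] = P₃ + 2P₂Z + 4P₁Z₂ + 8Z₃` (`Z₂, Z₃`
standing for `Z^[2], Z^[3]`, free parameters).  With the clique sums DEFINED from the slots (`hᵢ² = 0`), the
closed forms `D, D₂, D₃` and the σ-parametrisation of `CliqueUnitKills.T3_Km2235`:
`T₃(P₁ + 2Z) = 2⁷·(2s + 2u + 1 − 6t)·P₃ + 2⁸·(explicit)` — the remainder terms are all divisible by `2⁸`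
(`−8σ₂D₂Z` contributes `−128σ₂P₂Z`, `−64σ₀·2P₂Z` contributes `−128σ₀P₂Z`, and `σ₀ + σ₂ = 4t`).  Proof:
`TwoSlotGlue.T3_Km2235_frame` for the `Z`-free part and `linear_combination`. -/
theorem T3Z_Km2235_frame {R : Type*} [CommRing R] (h₀ h₁ h₂ h₃ h₄ h₅ σ₀ σ₁ σ₂ σ₃ s t u P₁ P₂ P₃ D D₂ D₃
    Z Z₂ Z₃ E₂ E₃ T₃Z : R) (qh₀ : h₀ * h₀ = 0) (qh₁ : h₁ * h₁ = 0) (qh₂ : h₂ * h₂ = 0) (qh₃ : h₃ * h₃ = 0)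
    (hP₁ : P₁ = h₀ + h₁ + h₂ + h₃)
    (hP₂ : P₂ = h₀ * h₁ + h₀ * h₂ + h₀ * h₃ + h₁ * h₂ + h₁ * h₃ + h₂ * h₃)
    (hP₃ : P₃ = h₀ * h₁ * h₂ + h₀ * h₁ * h₃ + h₀ * h₂ * h₃ + h₁ * h₂ * h₃)
    (hD : D = 4 * P₁ + 8 * h₄ + 32 * h₅)
    (hD₂ : D₂ = (256) * h₄ * h₅ + (128) * P₁ * h₅ + (32) * P₁ * h₄ + (16) * P₂)
    (hD₃ : D₃ = (1024) * P₁ * h₄ * h₅ + (512) * P₂ * h₅ + (128) * P₂ * h₄ + (64) * P₃)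
    (hE₂ : E₂ = P₂ + 2 * (P₁ * Z) + 4 * Z₂) (hE₃ : E₃ = P₃ + 2 * (P₂ * Z) + 4 * (P₁ * Z₂) + 8 * Z₃)
    (hT₃Z : T₃Z = σ₃ * D₃ - 4 * σ₂ * (D₂ * (P₁ + 2 * Z)) + 16 * σ₁ * (D * E₂) - 64 * σ₀ * E₃)
    (hσ₁ : σ₁ = 0) (hσ₂ : σ₂ = 4 * t - σ₀) (hσ₀ : σ₀ = 2 * s + 1) (hσ₃ : σ₃ = 4 * u) :
    T₃Z = 128 * ((2 * s + 2 * u + 1 - 6 * t) * P₃) + 256 * ((4) * P₁ * h₄ * h₅ + (16) * P₁ * h₄ * h₅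
      * u + (-16) * P₁ * h₄ * h₅ * t + (8) * P₁ * h₄ * h₅ * s + (4) * P₂ * h₅ + (8) * P₂ * h₅ * u +
      (-16) * P₂ * h₅ * t + (8) * P₂ * h₅ * s + P₂ * h₄ + (2) * P₂ * h₄ * u + (-4) * P₂ * h₄ * t +
      (2) * P₂ * h₄ * s - 2 * t * (P₂ * Z) - 8 * σ₂ * (h₄ * h₅ * Z) - 4 * σ₂ * (P₁ * h₅ * Z)
      - σ₂ * (P₁ * h₄ * Z) - σ₀ * (P₁ * Z₂) - 2 * σ₀ * Z₃) := by
  have hT := TwoSlotGlue.T3_Km2235_frame h₀ h₁ h₂ h₃ h₄ h₅ σ₀ σ₁ σ₂ σ₃ s t u P₁ P₂ P₃ D D₂ D₃ _ qh₀ qh₁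
    qh₂ qh₃ hP₁ hP₂ hP₃ rfl hD hD₂ hD₃ hσ₁ hσ₂ hσ₀ hσ₃
  subst hE₂ hE₃ hT₃Z
  linear_combination hT + (-8 * σ₂ * Z) * hD₂ + (16 * D * (2 * (P₁ * Z) + 4 * Z₂)) * hσ₁
    + (-128 * (P₂ * Z)) * hσ₂

open TwoSlotFrameTable in
open scoped IsMulCommutative in
/-- **LEMMA D(b), type (2,2,2,2,3,5), at `B = P₁ + 2Z` in the exterior algebra (the join).**  For six slots
`hᵢ = ι x_{2i} ι x_{2i+1}` of `ExteriorAlgebra R M` (any commutative ring `R`, any module `M`, any twelve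
vectors), parameters `s, t, u` and a remainder `Z` with its divided powers `Z₂, Z₃` — ANY elements of the 2-vector
(= even) subalgebra `Λ` —, the identity of `T3Z_Km2235_frame` holds with NO table hypothesis (`hᵢ² = 0` is
`twoVector_mul_self`, used inside the commutative ring `Λ`, `TwoSlotGlue.isMulCommutative_twoVectorSubalgebra`). -/
theorem T3Z_Km2235_exterior {R : Type*} [CommRing R] {M : Type*} [AddCommGroup M] [Module R M]
    (x₀ x₁ x₂ x₃ x₄ x₅ x₆ x₇ x₈ x₉ x₁₀ x₁₁ : M)
    (Λ : Subalgebra R (ExteriorAlgebra R M)) (h₀ h₁ h₂ h₃ h₄ h₅ σ₀ σ₁ σ₂ σ₃ s t u P₁ P₂ P₃ D D₂ D₃ Z Z₂ Z₃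
    E₂ E₃ T₃Z : ExteriorAlgebra R M) (hΛ : Λ = Algebra.adjoin R (Set.range fun p : M × M => ι R p.1 * ι R p.2))
    (hh₀ : h₀ = ι R x₀ * ι R x₁) (hh₁ : h₁ = ι R x₂ * ι R x₃) (hh₂ : h₂ = ι R x₄ * ι R x₅)
    (hh₃ : h₃ = ι R x₆ * ι R x₇) (hh₄ : h₄ = ι R x₈ * ι R x₉) (hh₅ : h₅ = ι R x₁₀ * ι R x₁₁)
    (ms : s ∈ Λ) (mt : t ∈ Λ) (mu : u ∈ Λ) (mZ : Z ∈ Λ) (mZ₂ : Z₂ ∈ Λ) (mZ₃ : Z₃ ∈ Λ)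
    (hP₁ : P₁ = h₀ + h₁ + h₂ + h₃)
    (hP₂ : P₂ = h₀ * h₁ + h₀ * h₂ + h₀ * h₃ + h₁ * h₂ + h₁ * h₃ + h₂ * h₃)
    (hP₃ : P₃ = h₀ * h₁ * h₂ + h₀ * h₁ * h₃ + h₀ * h₂ * h₃ + h₁ * h₂ * h₃)
    (hD : D = 4 * P₁ + 8 * h₄ + 32 * h₅)
    (hD₂ : D₂ = (256) * h₄ * h₅ + (128) * P₁ * h₅ + (32) * P₁ * h₄ + (16) * P₂)
    (hD₃ : D₃ = (1024) * P₁ * h₄ * h₅ + (512) * P₂ * h₅ + (128) * P₂ * h₄ + (64) * P₃)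
    (hE₂ : E₂ = P₂ + 2 * (P₁ * Z) + 4 * Z₂) (hE₃ : E₃ = P₃ + 2 * (P₂ * Z) + 4 * (P₁ * Z₂) + 8 * Z₃)
    (hT₃Z : T₃Z = σ₃ * D₃ - 4 * σ₂ * (D₂ * (P₁ + 2 * Z)) + 16 * σ₁ * (D * E₂) - 64 * σ₀ * E₃)
    (hσ₁ : σ₁ = 0) (hσ₂ : σ₂ = 4 * t - σ₀) (hσ₀ : σ₀ = 2 * s + 1) (hσ₃ : σ₃ = 4 * u) :
    T₃Z = 128 * ((2 * s + 2 * u + 1 - 6 * t) * P₃) + 256 * ((4) * P₁ * h₄ * h₅ + (16) * P₁ * h₄ * h₅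
      * u + (-16) * P₁ * h₄ * h₅ * t + (8) * P₁ * h₄ * h₅ * s + (4) * P₂ * h₅ + (8) * P₂ * h₅ * u +
      (-16) * P₂ * h₅ * t + (8) * P₂ * h₅ * s + P₂ * h₄ + (2) * P₂ * h₄ * u + (-4) * P₂ * h₄ * t +
      (2) * P₂ * h₄ * s - 2 * t * (P₂ * Z) - 8 * σ₂ * (h₄ * h₅ * Z) - 4 * σ₂ * (P₁ * h₅ * Z)
      - σ₂ * (P₁ * h₄ * Z) - σ₀ * (P₁ * Z₂) - 2 * σ₀ * Z₃) := by
  subst hΛ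
  haveI := TwoSlotGlue.isMulCommutative_twoVectorSubalgebra (R := R) (M := M)
  set Λ := Algebra.adjoin R (Set.range fun p : M × M => ι R p.1 * ι R p.2)
  have mh₀ : h₀ ∈ Λ := Algebra.subset_adjoin ⟨(x₀, x₁), hh₀.symm⟩
  have mh₁ : h₁ ∈ Λ := Algebra.subset_adjoin ⟨(x₂, x₃), hh₁.symm⟩
  have mh₂ : h₂ ∈ Λ := Algebra.subset_adjoin ⟨(x₄, x₅), hh₂.symm⟩
  have mh₃ : h₃ ∈ Λ := Algebra.subset_adjoin ⟨(x₆, x₇), hh₃.symm⟩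
  have mh₄ : h₄ ∈ Λ := Algebra.subset_adjoin ⟨(x₈, x₉), hh₄.symm⟩
  have mh₅ : h₅ ∈ Λ := Algebra.subset_adjoin ⟨(x₁₀, x₁₁), hh₅.symm⟩
  have qh₀ : (⟨h₀, mh₀⟩ : Λ) * ⟨h₀, mh₀⟩ = 0 := Subtype.ext (by subst hh₀; exact twoVector_mul_self x₀ x₁)
  have qh₁ : (⟨h₁, mh₁⟩ : Λ) * ⟨h₁, mh₁⟩ = 0 := Subtype.ext (by subst hh₁; exact twoVector_mul_self x₂ x₃)
  have qh₂ : (⟨h₂, mh₂⟩ : Λ) * ⟨h₂, mh₂⟩ = 0 := Subtype.ext (by subst hh₂; exact twoVector_mul_self x₄ x₅)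
  have qh₃ : (⟨h₃, mh₃⟩ : Λ) * ⟨h₃, mh₃⟩ = 0 := Subtype.ext (by subst hh₃; exact twoVector_mul_self x₆ x₇)
  subst hP₁ hP₂ hP₃ hD hD₂ hD₃ hE₂ hE₃ hT₃Z hσ₁ hσ₂ hσ₀ hσ₃
  have key := congrArg Subtype.val
    (T3Z_Km2235_frame (R := Λ) ⟨h₀, mh₀⟩ ⟨h₁, mh₁⟩ ⟨h₂, mh₂⟩ ⟨h₃, mh₃⟩ ⟨h₄, mh₄⟩ ⟨h₅, mh₅⟩ _ _ _ _
      ⟨s, ms⟩ ⟨t, mt⟩ ⟨u, mu⟩ _ _ _ _ _ _ ⟨Z, mZ⟩ ⟨Z₂, mZ₂⟩ ⟨Z₃, mZ₃⟩ _ _ _ qh₀ qh₁ qh₂ qh₃ rfl rfl rfl rfl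
      rfl rfl rfl rfl rfl rfl rfl rfl rfl)
  push_cast at key ⊢
  exact key

/-- **LEMMA D(b) READING with remainder, type (2,2,2,2,3,5): the clique unit is CLASS-DEAD.**  Setting of
`T3Z_Km2235_exterior` at `R = ℤ`, `xᵢ` a basis of the free `ℤ`-module `M`, σ-parameters `s, t, u` ANY even
elements (in the application integers), ANY even remainder `Z` (with `Z₂, Z₃` for its divided powers):
`T₃(P₁ + 2Z)` is NOT of the form `256 · Z'` — so CRITERION L's `k = 3` congruence `≡ 0 mod 2^{10}` fails for
every completion of the leading digit `P₁`: the memo's `(k, v, g) = (3, 7, 8)` (V)-kill (S2-21 §5 LEMMA D(b); of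
record machine ×2 + pencil + `verify_lemmaDE.py` + KERNEL for the identities) with its READING now a theorem.
Proof: the functional `Φ = τ ∘ Λ(π)` of `lemmaB_reading`: `Φ(P₃) = Φ(h₀h₁h₂) = 1`, so
`Φ((2s + 2u + 1 − 6t)·P₃) = 1 + 2·(…)` is odd.  The other six clique types compose identically and are not
restated here. -/
theorem lemmaD_b_reading_Km2235_completion {M : Type*} [AddCommGroup M] [Module ℤ M]
    (x : Module.Basis (Fin 12) ℤ M)
    (Λ : Subalgebra ℤ (ExteriorAlgebra ℤ M)) (h₀ h₁ h₂ h₃ h₄ h₅ σ₀ σ₁ σ₂ σ₃ s t u P₁ P₂ P₃ D D₂ D₃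
    Z Z₂ Z₃ E₂ E₃ T₃Z : ExteriorAlgebra ℤ M)
    (hΛ : Λ = Algebra.adjoin ℤ (Set.range fun p : M × M => ι ℤ p.1 * ι ℤ p.2))
    (hh₀ : h₀ = ι ℤ (x 0) * ι ℤ (x 1)) (hh₁ : h₁ = ι ℤ (x 2) * ι ℤ (x 3)) (hh₂ : h₂ = ι ℤ (x 4) * ι ℤ (x 5))
    (hh₃ : h₃ = ι ℤ (x 6) * ι ℤ (x 7)) (hh₄ : h₄ = ι ℤ (x 8) * ι ℤ (x 9)) (hh₅ : h₅ = ι ℤ (x 10) * ι ℤ (x 11))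
    (ms : s ∈ Λ) (mt : t ∈ Λ) (mu : u ∈ Λ) (mZ : Z ∈ Λ) (mZ₂ : Z₂ ∈ Λ) (mZ₃ : Z₃ ∈ Λ)
    (hP₁ : P₁ = h₀ + h₁ + h₂ + h₃)
    (hP₂ : P₂ = h₀ * h₁ + h₀ * h₂ + h₀ * h₃ + h₁ * h₂ + h₁ * h₃ + h₂ * h₃)
    (hP₃ : P₃ = h₀ * h₁ * h₂ + h₀ * h₁ * h₃ + h₀ * h₂ * h₃ + h₁ * h₂ * h₃)
    (hD : D = 4 * P₁ + 8 * h₄ + 32 * h₅)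
    (hD₂ : D₂ = (256) * h₄ * h₅ + (128) * P₁ * h₅ + (32) * P₁ * h₄ + (16) * P₂)
    (hD₃ : D₃ = (1024) * P₁ * h₄ * h₅ + (512) * P₂ * h₅ + (128) * P₂ * h₄ + (64) * P₃)
    (hE₂ : E₂ = P₂ + 2 * (P₁ * Z) + 4 * Z₂) (hE₃ : E₃ = P₃ + 2 * (P₂ * Z) + 4 * (P₁ * Z₂) + 8 * Z₃)
    (hT₃Z : T₃Z = σ₃ * D₃ - 4 * σ₂ * (D₂ * (P₁ + 2 * Z)) + 16 * σ₁ * (D * E₂) - 64 * σ₀ * E₃)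
    (hσ₁ : σ₁ = 0) (hσ₂ : σ₂ = 4 * t - σ₀) (hσ₀ : σ₀ = 2 * s + 1) (hσ₃ : σ₃ = 4 * u) :
    ∀ Z' : ExteriorAlgebra ℤ M, T₃Z ≠ 256 * Z' := by
  intro Z' hZ
  obtain ⟨W, hW⟩ : ∃ W, T₃Z = 128 * ((2 * s + 2 * u + 1 - 6 * t) * P₃) + 256 * W :=
    ⟨_, T3Z_Km2235_exterior (x 0) (x 1) (x 2) (x 3) (x 4) (x 5) (x 6) (x 7) (x 8) (x 9) (x 10) (x 11) Λ h₀ h₁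
      h₂ h₃ h₄ h₅ σ₀ σ₁ σ₂ σ₃ s t u P₁ P₂ P₃ D D₂ D₃ Z Z₂ Z₃ E₂ E₃ T₃Z hΛ hh₀ hh₁ hh₂ hh₃ hh₄ hh₅ ms mt mu
      mZ mZ₂ mZ₃ hP₁ hP₂ hP₃ hD hD₂ hD₃ hE₂ hE₃ hT₃Z hσ₁ hσ₂ hσ₀ hσ₃⟩
  obtain ⟨τ, hτ⟩ := exists_topCoeff ℤ 6
  rw [hZ] at hW
  have key := congrArg (fun z => τ (ExteriorAlgebra.map
    (LinearMap.funLeft ℤ ℤ (Fin.castLE (show 6 ≤ 12 by decide)) ∘ₗ (x.equivFun : M →ₗ[ℤ] (Fin 12 → ℤ))) z)) hW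
  subst hP₃ hh₀ hh₁ hh₂ hh₃ hh₄ hh₅
  simp only [map_mul, map_add, map_sub, map_apply_ι, projSix_basis, Matrix.cons_val, map_ofNat, map_zero,
    mul_zero, add_zero, mul_add, add_mul, sub_mul, one_mul, mul_assoc, prod_six_eq_ιMulti,
    apply_ofNat_mul τ 256, apply_ofNat_mul τ 128, apply_ofNat_mul τ 2, apply_ofNat_mul τ 6, hτ] at key
  norm_num at key
  omega

end Completion

end Summit.Ventures.HSemireg.TwoAdicReadings
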